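import Summits.QuantumFields.BalabanUV.Gaps.EndDrawdownLinearSegmentBarrier
import Summits.QuantumFields.BalabanUV.Gaps.EndDrawdownLinearThresholdRenormPieces
import Summits.QuantumFields.BalabanUV.Gaps.EndDrawdownLinearThresholdRenormFine

/-!
# Gaps / EndDrawdownLinearThresholdRenormSuff — THE OCTAL THRESHOLD, SUFFICIENCY WITH `8^m` EULER PIECES PER BLOCK: a kernel CRITERION reducing
# possibility of the octal staircase on the linear road to a FINITE computation with an explicit real recursion, and one certified instance.
# Backward piece map `r(x) = x − τ_m(1 − C∕√x)` (`τ_m = 7∕8^m`; the slope of a piece evaluated at its TOP), backward block map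
# `B_m(κ) = r^{[8^m]}(4κ)`, iterates `ν_n = B_m^n(C²)` from the tail floor.  **`endPossibleLin_bOct_of_escape`**: if `2C² ≥ τ_m` (pieces stay above the
# equilibrium) and SOME `ν_{n₀} > 7∕3`, then `bOct` is POSSIBLE on the linear road with constant `C`: the segment barrier
# (`EndDrawdownLinearSegmentBarrier.isBarrier_segInterp`) with `8^m` pieces on the last `n₀` blocks before the flattening block and ONE piece per block
# below them — where the scaled height exceeds `7∕3` and the one-piece recursion `R` of (X11) diverges, `R(κ) − 7∕3 ≥ 4(κ − 7∕3)` — reaches every level.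
# Instance **`endPossibleLin_bOct_090`** (`m = 1`, forty certified pieces, rational square-root witnesses): `C = 9∕10` is POSSIBLE, so with (X12) the
# KERNEL bracket of the octal threshold is **`C⋆ ∈ [0.8, 0.9]`** (`exists_threshold_bOct_decimal`) around the conjectured `√(84∕(77+72 log 2)) ≈ 0.8136` (seat g1-p3
# GEN 11, rows CAP ∕ tail ∕ (D4) «split ∕ weakening»; this seat՚s own leaf; file 31 of «the one-loop interface of the END statement»)

HONEST FRAMING (cell rule, page 1 of everything): [folklore] window arithmetic for ONE explicit toy sequence fed to the kernel-checked barrier criterion; the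
hypothesis `ν_{n₀} > 7∕3` is an explicit real inequality; `EndPossibleLin` is a quantified READING of the cell's END-grade statement over Bałaban-free data
`(b, C, γ₀)`, not a binder; NOTHING of Bałaban's table is certified (NODE-O 0∕1, CAP coefficients 0); words ∕ odds of rows CAP ∕ tail ∕ (D4) ∕ (D1)
UNCHANGED; 0∕6 binders; one finite T⁴; NOT [I] Thm 2, NOT `BetaPertH`, NOT the continuum limit, NOT Clay.

CITATION HEADER (tags CONTEXT ONLY).  [I] = T. Bałaban, Commun. Math. Phys. **109** (1987) 249–301 [Balaban1987RG1]: (0.20) p. 256, Thm 2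
p. 259 (first sentence), (2.12)–(2.14) p. 268.
-/

namespace Summit.QuantumFields.BalabanUV.Gaps.EndDrawdownLinearThresholdRenormSuff

open Summit.QuantumFields.BalabanUV.Gaps.EndDrawdownLinearRoad
open Summit.QuantumFields.BalabanUV.Gaps.EndDrawdownCooperatorExtremal
open Summit.QuantumFields.BalabanUV.Gaps.EndDrawdownLinearBarrier
open Summit.QuantumFields.BalabanUV.Gaps.EndDrawdownLinearSegmentBarrier
open Summit.QuantumFields.BalabanUV.Gaps.EndDrawdownLinearThreshold
open Summit.QuantumFields.BalabanUV.Gaps.EndDrawdownLinearThresholdRenorm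
open Summit.QuantumFields.BalabanUV.Gaps.EndDrawdownLinearThresholdRenormPieces
open Summit.QuantumFields.BalabanUV.Gaps.EndDrawdownLinearThresholdRenormFine (not_endPossibleLin_bOct_080)
open Finset

noncomputable section

/-! ## §1 The scaled heights: values, lower bounds, one-step relations -/

section Kap

variable {C : ℝ} (m n₀ t₁ : ℕ)

/-- Below `t₁`: `κ_t = R^{[t₁−t]}(ν_{n₀})`. [folklore] -/
theorem kap_of_le {t : ℕ} (h : t ≤ t₁) : kap C m n₀ t₁ t = (R C)^[t₁ - t] (nu m C n₀) := if_pos h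

/-- On the certified blocks: `κ_t = ν_{T−t}` (`T = t₁ + n₀`). [folklore] -/
theorem kap_of_mid {t : ℕ} (h1 : t₁ ≤ t) (h2 : t ≤ t₁ + n₀) : kap C m n₀ t₁ t = nu m C (t₁ + n₀ - t) := by
  unfold kap
  by_cases h : t ≤ t₁
  · rw [if_pos h, show t₁ - t = 0 by omega, show t₁ + n₀ - t = n₀ by omega]; rfl
  · rw [if_neg h, if_pos h2]

/-- Above the flattening block: `κ_t = C²`. [folklore] -/
theorem kap_of_ge {t : ℕ} (h : t₁ + n₀ ≤ t) : kap C m n₀ t₁ t = C ^ 2 := by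
  unfold kap
  by_cases h1 : t ≤ t₁
  · rw [if_pos h1, show t₁ - t = 0 by omega, show n₀ = 0 by omega]; rfl
  · by_cases h2 : t ≤ t₁ + n₀
    · rw [if_neg h1, if_pos h2, show t₁ + n₀ - t = 0 by omega]; rfl
    · rw [if_neg h1, if_neg h2]

/-- One step below `t₁`: `κ_t = R(κ_{t+1})` for `t < t₁`. [folklore] -/
theorem kap_step_R {t : ℕ} (h : t < t₁) : kap C m n₀ t₁ t = R C (kap C m n₀ t₁ (t + 1)) := by
  rw [kap_of_le m n₀ t₁ h.le, kap_of_le m n₀ t₁ h, show t₁ - t = (t₁ - (t + 1)) + 1 by omega,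
    Function.iterate_succ_apply']

/-- One step on the certified blocks: `κ_t = B_m(κ_{t+1})` for `t₁ ≤ t < T`. [folklore] -/
theorem kap_step_B {t : ℕ} (h1 : t₁ ≤ t) (h2 : t < t₁ + n₀) : kap C m n₀ t₁ t = Bm m C (kap C m n₀ t₁ (t + 1)) := by
  rw [kap_of_mid m n₀ t₁ h1 (by omega), kap_of_mid m n₀ t₁ (by omega) (by omega),
    show t₁ + n₀ - t = (t₁ + n₀ - (t + 1)) + 1 by omega]
  rfl

variable (hC : 0 < C) (hCτ : tauS m ≤ 2 * C ^ 2) (hcert : 7 / 3 < nu m C n₀)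
include hC hCτ hcert

omit hCτ in
/-- Below `t₁` the heights exceed `7∕3`: `κ_t ≥ 7∕3 + 4^{t₁−t}(ν_{n₀} − 7∕3)`. [folklore] -/
theorem kap_ge_of_le {t : ℕ} (h : t ≤ t₁) : 7 / 3 + 4 ^ (t₁ - t) * (nu m C n₀ - 7 / 3) ≤ kap C m n₀ t₁ t := by
  rw [kap_of_le m n₀ t₁ h]; exact iterate_R_ge hC.le hcert _

/-- All heights are `≥ C²` (hence positive). [folklore] -/
theorem sq_le_kap (t : ℕ) : C ^ 2 ≤ kap C m n₀ t₁ t := by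
  by_cases h : t ≤ t₁
  · have h1 := kap_ge_of_le m n₀ t₁ hC hcert h
    have h2 : (0 : ℝ) ≤ 4 ^ (t₁ - t) * (nu m C n₀ - 7 / 3) := mul_nonneg (by positivity) (by linarith)
    have h3 : C ^ 2 ≤ nu m C n₀ := sq_le_nu hC m hCτ n₀
    -- `ν_{n₀} > 7∕3`, and `κ_t ≥ 7∕3 + 4^j(ν−7∕3) ≥ ν ≥ C²` since `4^j ≥ 1`
    have h4 : (1 : ℝ) ≤ 4 ^ (t₁ - t) := one_le_pow₀ (by norm_num)
    nlinarith
  · by_cases h2 : t ≤ t₁ + n₀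
    · rw [kap_of_mid m n₀ t₁ (by omega) h2]; exact sq_le_nu hC m hCτ _
    · rw [kap_of_ge m n₀ t₁ (by omega)]

/-- The block-entry heights are non-decreasing: `4^t κ_t ≤ 4^{t+1} κ_{t+1}`. [folklore] -/
theorem kap_mono (t : ℕ) : 4 ^ t * kap C m n₀ t₁ t ≤ 4 ^ (t + 1) * kap C m n₀ t₁ (t + 1) := by
  have h4 : (0 : ℝ) < 4 ^ t := by positivity
  have hnext := sq_le_kap m n₀ t₁ hC hCτ hcert (t + 1)
  rw [pow_succ]
  suffices h : kap C m n₀ t₁ t ≤ 4 * kap C m n₀ t₁ (t + 1) by nlinarith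
  by_cases ht : t < t₁
  · rw [kap_step_R m n₀ t₁ ht]; exact R_le hC (by linarith [sq_nonneg C])
  · by_cases ht2 : t < t₁ + n₀
    · rw [kap_step_B m n₀ t₁ (by omega) ht2]
      unfold Bm
      exact (iterate_rStep_mem hC (tauS_pos m).le hCτ (by linarith [sq_nonneg C]) _).2
    · rw [kap_of_ge m n₀ t₁ (by omega), kap_of_ge m n₀ t₁ (by omega)]
      nlinarith [sq_nonneg C]

end Kap

/-! ## §2 The heights: case formulas, monotonicity, the slope condition, the barrier -/

section Heights

variable {C : ℝ} (m n₀ t₁ : ℕ)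

/-- Up to `t₁` the height is the block-entry height: `H k = 4^k κ_k` for `k ≤ t₁`. [folklore] -/
theorem Hseg_of_le {k : ℕ} (hk : k ≤ t₁) : Hseg C m n₀ t₁ k = 4 ^ k * kap C m n₀ t₁ k := by
  rcases lt_or_eq_of_le hk with hk | rfl
  · exact if_pos hk
  · unfold Hseg
    rw [if_neg (lt_irrefl _), (blkOf_t1 m k).1, (blkOf_t1 m k).2, Nat.sub_zero]
    by_cases hn : k < k + n₀
    · rw [if_pos hn, kap_step_B m n₀ k le_rfl hn]; rfl
    · rw [if_neg hn, kap_of_ge m n₀ k (t := k) (by omega), show k + n₀ = k by omega]; ring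

/-- On the certified blocks (`t = blkOf k < T`, `j = pcOf k`): `H k = 4^t · r(x)` and `H (k+1) = 4^t · x` with `x = r^{[8^m−j−1]}(4κ_{t+1})`. [folklore] -/
theorem Hseg_pair_mid {k : ℕ} (hk : t₁ ≤ k) (ht : blkOf m t₁ k < t₁ + n₀) :
    Hseg C m n₀ t₁ k = 4 ^ blkOf m t₁ k * rStep C (tauS m)
        ((rStep C (tauS m))^[8 ^ m - pcOf m t₁ k - 1] (4 * kap C m n₀ t₁ (blkOf m t₁ k + 1))) ∧
      Hseg C m n₀ t₁ (k + 1) = 4 ^ blkOf m t₁ k *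
        (rStep C (tauS m))^[8 ^ m - pcOf m t₁ k - 1] (4 * kap C m n₀ t₁ (blkOf m t₁ k + 1)) := by
  have hj := pcOf_lt m t₁ k
  have hk' : ¬ k < t₁ := by omega
  constructor
  · have e : Hseg C m n₀ t₁ k = 4 ^ blkOf m t₁ k *
        (rStep C (tauS m))^[8 ^ m - pcOf m t₁ k] (4 * kap C m n₀ t₁ (blkOf m t₁ k + 1)) := by
      unfold Hseg; rw [if_neg hk', if_pos ht]
    rw [e]
    conv_lhs => rw [show 8 ^ m - pcOf m t₁ k = (8 ^ m - pcOf m t₁ k - 1) + 1 by omega, Function.iterate_succ_apply']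
  · unfold Hseg
    rw [if_neg (by omega)]
    by_cases hj1 : pcOf m t₁ k + 1 < 8 ^ m
    · obtain ⟨hb, hp⟩ := step_in m t₁ hk hj1
      rw [hb, hp, if_pos ht, show 8 ^ m - (pcOf m t₁ k + 1) = 8 ^ m - pcOf m t₁ k - 1 by omega]
    · have hj1' : pcOf m t₁ k + 1 = 8 ^ m := by omega
      obtain ⟨hb, hp⟩ := step_out m t₁ hk hj1'
      rw [hb, hp, show 8 ^ m - pcOf m t₁ k - 1 = 0 by omega, Function.iterate_zero_apply, pow_succ]
      by_cases ht1 : blkOf m t₁ k + 1 < t₁ + n₀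
      · rw [if_pos ht1, Nat.sub_zero, kap_step_B m n₀ t₁ (by have := t1_le_blkOf m t₁ hk; omega) ht1]; unfold Bm; ring
      · rw [if_neg ht1, kap_of_ge m n₀ t₁ (by omega), show t₁ + n₀ = blkOf m t₁ k + 1 by omega, pow_succ]; ring

/-- Above the flattening block both heights are the flat top. [folklore] -/
theorem Hseg_pair_top {k : ℕ} (hk : t₁ ≤ k) (ht : t₁ + n₀ ≤ blkOf m t₁ k) :
    Hseg C m n₀ t₁ k = C ^ 2 * 4 ^ (t₁ + n₀) ∧ Hseg C m n₀ t₁ (k + 1) = C ^ 2 * 4 ^ (t₁ + n₀) := by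
  have hb : blkOf m t₁ k ≤ blkOf m t₁ (k + 1) := by
    rw [blkOf_ge m t₁ hk, blkOf_ge m t₁ (by omega)]; exact Nat.add_le_add_left (Nat.div_le_div_right (by omega)) _
  unfold Hseg
  rw [if_neg (by omega), if_neg (by omega), if_neg (by omega), if_neg (by omega)]
  exact ⟨rfl, rfl⟩

variable (hC : 0 < C) (hm : m ≤ t₁) (hCτ : tauS m ≤ 2 * C ^ 2) (hcert : 7 / 3 < nu m C n₀)
include hC hm hCτ hcert

omit hm in
/-- The heights are non-decreasing. [folklore] -/
theorem Hseg_mono : Monotone (Hseg C m n₀ t₁) := by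
  refine monotone_nat_of_le_succ fun k => ?_
  by_cases hk : k < t₁
  · rw [Hseg_of_le m n₀ t₁ hk.le, Hseg_of_le m n₀ t₁ (by omega)]
    exact kap_mono m n₀ t₁ hC hCτ hcert k
  · by_cases ht : blkOf m t₁ k < t₁ + n₀
    · obtain ⟨e1, e2⟩ := Hseg_pair_mid m n₀ t₁ (not_lt.mp hk) ht
      rw [e1, e2]
      have h4 : (0 : ℝ) < 4 ^ blkOf m t₁ k := by positivity
      have hx := (iterate_rStep_mem hC (tauS_pos m).le hCτ
        (show C ^ 2 ≤ 4 * kap C m n₀ t₁ (blkOf m t₁ k + 1) by nlinarith [sq_le_kap m n₀ t₁ hC hCτ hcert (blkOf m t₁ k + 1), sq_nonneg C])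
        (8 ^ m - pcOf m t₁ k - 1)).1
      exact mul_le_mul_of_nonneg_left (rStep_le hC (tauS_pos m).le hx) h4.le
    · obtain ⟨e1, e2⟩ := Hseg_pair_top m n₀ t₁ (not_lt.mp hk) (not_lt.mp ht)
      rw [e1, e2]

/-- The flat top bounds every height. [folklore] -/
theorem Hseg_le_top (k : ℕ) : Hseg C m n₀ t₁ k ≤ C ^ 2 * 4 ^ (t₁ + n₀) := by
  set K := t₁ + n₀ * 8 ^ m + k with hK
  have hKt : t₁ + n₀ ≤ blkOf m t₁ K := by
    rw [blkOf_ge m t₁ (by omega), show K - t₁ = n₀ * 8 ^ m + k by omega]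
    have : n₀ ≤ (n₀ * 8 ^ m + k) / 8 ^ m := by
      rw [Nat.le_div_iff_mul_le (by positivity)]; omega
    omega
  have hflat := (Hseg_pair_top (C := C) m n₀ t₁ (show t₁ ≤ K by omega) hKt).1
  rw [← hflat]
  exact Hseg_mono m n₀ t₁ hC hCτ hcert (by omega)

omit hm hCτ in
/-- The foot: `H 0 = κ_0 ≥ 7∕3 + 4^{t₁}(ν_{n₀} − 7∕3)`. [folklore] -/
theorem Hseg_zero_ge : 7 / 3 + 4 ^ t₁ * (nu m C n₀ - 7 / 3) ≤ Hseg C m n₀ t₁ 0 := by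
  rw [Hseg_of_le m n₀ t₁ (Nat.zero_le _), pow_zero, one_mul]
  simpa using kap_ge_of_le m n₀ t₁ hC hcert (Nat.zero_le t₁)

/-- **THE SLOPE CONDITION on every segment**: `2^{−t} − C∕√H(k+1) ≤ slope_k` for each index of segment `k` (block `t = blkOf k`): EQUALITY below `t₁`
(the recursion `R`) and on the certified pieces (the recursion `r`), the tail floor above. [folklore] -/
theorem Hseg_slope (k i : ℕ) (h1 : Nseg m t₁ k ≤ i) (h2 : i < Nseg m t₁ (k + 1)) :
    -bOct i - C / Real.sqrt (Hseg C m n₀ t₁ (k + 1)) ≤ segSlope (Nseg m t₁) (Hseg C m n₀ t₁) k := by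
  obtain ⟨hb1, hb2⟩ := mem_blk_of_seg m t₁ hm h1 h2
  have hbi : bOct i = -(1 / 2 ^ blkOf m t₁ k) := by
    show -(1 / (2 : ℝ) ^ blk8 i) = _
    have := bs8_add_one (blkOf m t₁ k); have := bs8_add_one (blkOf m t₁ k + 1)
    rw [blk8_of_mem (t := blkOf m t₁ k) (by omega) (by omega)]
  rw [hbi, neg_neg]
  unfold segSlope
  rw [segLen_cast m t₁ hm k]
  by_cases hk : k < t₁
  · -- the recursion `R`: equality
    rw [if_pos hk, blkOf_lt m t₁ hk, Hseg_of_le m n₀ t₁ hk.le,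
      Hseg_of_le m n₀ t₁ (show k + 1 ≤ t₁ by omega), kap_step_R m n₀ t₁ hk]
    set κ := kap C m n₀ t₁ (k + 1)
    have hκ : 0 < κ := lt_of_lt_of_le (by positivity) (sq_le_kap m n₀ t₁ hC hCτ hcert (k + 1))
    have hsq : Real.sqrt (4 ^ (k + 1) * κ) = 2 ^ (k + 1) * Real.sqrt κ := by
      rw [Real.sqrt_mul (by positivity), show (4 : ℝ) ^ (k + 1) = (2 ^ (k + 1)) ^ 2 by rw [← pow_mul, mul_comm, pow_mul]; norm_num,
        Real.sqrt_sq (by positivity)]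
    have hspos : 0 < Real.sqrt κ := Real.sqrt_pos.mpr hκ
    rw [hsq, R, show (4 : ℝ) ^ (k + 1) = 4 ^ k * 4 from pow_succ 4 k, show (2 : ℝ) ^ (k + 1) = 2 ^ k * 2 from pow_succ 2 k, eight_pow]
    apply le_of_eq; field_simp; ring
  · by_cases ht : blkOf m t₁ k < t₁ + n₀
    · -- the recursion `r`: equality
      obtain ⟨e1, e2⟩ := Hseg_pair_mid m n₀ t₁ (not_lt.mp hk) ht
      rw [if_neg hk, e1, e2]
      set t := blkOf m t₁ k
      set x := (rStep C (tauS m))^[8 ^ m - pcOf m t₁ k - 1] (4 * kap C m n₀ t₁ (t + 1))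
      have hx : C ^ 2 ≤ x := (iterate_rStep_mem hC (tauS_pos m).le hCτ
        (show C ^ 2 ≤ 4 * kap C m n₀ t₁ (t + 1) by nlinarith [sq_le_kap m n₀ t₁ hC hCτ hcert (t + 1), sq_nonneg C]) _).1
      have hxpos : 0 < x := lt_of_lt_of_le (by positivity) hx
      have hsq : Real.sqrt (4 ^ t * x) = 2 ^ t * Real.sqrt x := by
        rw [Real.sqrt_mul (by positivity), (show (4 : ℝ) ^ t = (2 ^ t) ^ 2 by rw [← pow_mul, mul_comm, pow_mul]; norm_num), Real.sqrt_sq (by positivity)]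
      have hspos : 0 < Real.sqrt x := Real.sqrt_pos.mpr hxpos
      have hmt : m ≤ t := hm.trans (t1_le_blkOf m t₁ (not_lt.mp hk))
      have h8 : (8 : ℝ) ^ t = 8 ^ (t - m) * 8 ^ m := by rw [← pow_add, Nat.sub_add_cancel hmt]
      rw [hsq, rStep, tauS]
      rw [eight_pow] at h8
      apply le_of_eq; field_simp
      -- both sides polynomial in 2^t, 4^t, 8^(t-m), 8^m, √x
      nlinarith [h8]
    · -- the tail floor
      obtain ⟨e1, e2⟩ := Hseg_pair_top m n₀ t₁ (not_lt.mp hk) (not_lt.mp ht)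
      rw [if_neg hk, e1, e2, sub_self, zero_div, sqrt_mul_four_pow (sq_nonneg C), Real.sqrt_sq hC.le,
        show C / (C * 2 ^ (t₁ + n₀)) = 1 / 2 ^ (t₁ + n₀) by rw [← div_div, div_self hC.ne'], sub_nonpos]
      exact one_div_le_one_div_of_le (by positivity) (pow_le_pow_right₀ (by norm_num) (not_lt.mp ht))

/-- **THE SEGMENT INTERPOLANT IS A BARRIER** between the foot `H 0` and the flat top. [folklore] -/
theorem isBarrier_octal : IsBarrier bOct C (Hseg C m n₀ t₁ 0) (C ^ 2 * 4 ^ (t₁ + n₀))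
    (segInterp (Nseg m t₁) (Nseg_strictMono m t₁ hm) (Hseg C m n₀ t₁)) := by
  have hfoot : 0 < Hseg C m n₀ t₁ 0 := by
    have h := Hseg_zero_ge m n₀ t₁ hC hcert
    have : (0 : ℝ) ≤ 4 ^ t₁ * (nu m C n₀ - 7 / 3) := mul_nonneg (by positivity) (by linarith)
    linarith
  exact isBarrier_segInterp (Nseg m t₁) (Nseg_zero m t₁ hm) (Nseg_strictMono m t₁ hm) (Hseg C m n₀ t₁) hC.le
    (Hseg_mono m n₀ t₁ hC hCτ hcert) hfoot le_rfl (Hseg_le_top m n₀ t₁ hC hm hCτ hcert)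
    (Hseg_slope m n₀ t₁ hC hm hCτ hcert)

end Heights

/-- **THE OCTAL STAIRCASE IS POSSIBLE ON THE LINEAR ROAD WHENEVER THE `8^m`-PIECE BACKWARD RECURSION ESCAPES ABOVE `7∕3`**: `C > 0`,
`τ_m ≤ 2C²`, and `ν_{n₀} > 7∕3` for some `n₀` ⟹ `EndPossibleLin bOct C γ₀` (every box). [cite: Balaban1987RG1, Thm 2 p.259 (first sentence) and (2.12)–(2.14) p.268] -/
theorem endPossibleLin_bOct_of_escape {C : ℝ} (hC : 0 < C) {m : ℕ} (hCτ : tauS m ≤ 2 * C ^ 2) {n₀ : ℕ}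
    (hcert : 7 / 3 < nu m C n₀) {γ₀ : ℝ} (hγ₀ : 0 < γ₀) : EndPossibleLin bOct C γ₀ := by
  refine (endPossibleLin_iff_barrier hC.le hγ₀).mpr fun A _ => ?_
  -- choose `t₁ ≥ m` with `7∕3 + 4^{t₁}(ν − 7∕3) ≥ A`
  obtain ⟨t₀, ht₀⟩ := pow_unbounded_of_one_lt (A / (nu m C n₀ - 7 / 3)) (by norm_num : (1 : ℝ) < 4)
  set t₁ := max t₀ m with ht₁
  have hm : m ≤ t₁ := le_max_right _ _
  refine ⟨C ^ 2 * 4 ^ (t₁ + n₀), _, (isBarrier_octal m n₀ t₁ hC hm hCτ hcert).mono_level ?_⟩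
  have h1 := Hseg_zero_ge m n₀ t₁ hC hcert
  have hδ : 0 < nu m C n₀ - 7 / 3 := by linarith
  rw [div_lt_iff₀ hδ] at ht₀
  have h4 : (4 : ℝ) ^ t₀ ≤ 4 ^ t₁ := pow_le_pow_right₀ (by norm_num) (le_max_left _ _)
  nlinarith

/-! ## §3 A numeric instance: `C = 9∕10` is possible (`m = 1`, five blocks of eight certified pieces) -/

/-- **THE OCTAL STAIRCASE IS POSSIBLE ON THE LINEAR ROAD WITH `C = 9∕10`** (every box): `τ_1 = 7∕8 ≤ 2C² = 81∕50`, and forty certified backward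
pieces (rational square-root witnesses generated by exact rational arithmetic, `g11/scripts/certify_threshold.py` logic) give `ν_5 ≥ 2.489 > 7∕3`.  With
(X12)'s `not_endPossibleLin_bOct_080` the KERNEL bracket of the octal threshold is **`0.8 ≤ C⋆ ≤ 0.9`** (conjectured `0.8136`).
[cite: Balaban1987RG1, Thm 2 p.259 (first sentence) and (2.12)–(2.14) p.268] -/
theorem endPossibleLin_bOct_090 {γ₀ : ℝ} (hγ₀ : 0 < γ₀) : EndPossibleLin bOct (9 / 10) γ₀ := by
  have hC : (0 : ℝ) < 9 / 10 := by norm_num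
  have ht : tauS 1 = 7 / 8 := by norm_num [tauS]
  have hCτ : tauS 1 ≤ 2 * (9 / 10 : ℝ) ^ 2 := by rw [ht]; norm_num
  have hCτ' : 0 ≤ tauS 1 ∧ tauS 1 ≤ 2 * (9 / 10 : ℝ) ^ 2 := ⟨(tauS_pos 1).le, hCτ⟩
  have g0 : (81 / 100 : ℝ) ≤ nu 1 (9 / 10) 0 := by show (81 / 100 : ℝ) ≤ (9 / 10) ^ 2; norm_num
  -- block 1: ν_1 = r^[8](4·ν_0) ≥ 947889 / 1000000
  have b0_0 : (81 / 25 : ℝ) ≤ (rStep (9 / 10) (tauS 1))^[0] (4 * nu 1 (9 / 10) 0) := by rw [Function.iterate_zero, id]; linarith [g0]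
  have b0_1 := iterate_rStep_ge_step hC hCτ' b0_0 (by norm_num) (s := 1800001 / 1000000) (xnew := 2802499 / 1000000) (by norm_num) (by norm_num) (by rw [ht]; norm_num)
  have b0_2 := iterate_rStep_ge_step hC hCτ' b0_1 (by norm_num) (s := 1674067 / 1000000) (xnew := 239791 / 100000) (by norm_num) (by norm_num) (by rw [ht]; norm_num)
  have b0_3 := iterate_rStep_ge_step hC hCτ' b0_2 (by norm_num) (s := 1548519 / 1000000) (xnew := 101573 / 50000) (by norm_num) (by norm_num) (by rw [ht]; norm_num)
  have b0_4 := iterate_rStep_ge_step hC hCτ' b0_3 (by norm_num) (s := 1425293 / 1000000) (xnew := 1708977 / 1000000) (by norm_num) (by norm_num) (by rw [ht]; norm_num)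
  have b0_5 := iterate_rStep_ge_step hC hCτ' b0_4 (by norm_num) (s := 1307279 / 1000000) (xnew := 1436373 / 1000000) (by norm_num) (by norm_num) (by rw [ht]; norm_num)
  have b0_6 := iterate_rStep_ge_step hC hCτ' b0_5 (by norm_num) (s := 149811 / 125000) (xnew := 24369 / 20000) (by norm_num) (by norm_num) (by rw [ht]; norm_num)
  have b0_7 := iterate_rStep_ge_step hC hCτ' b0_6 (by norm_num) (s := 220767 / 200000) (xnew := 1056871 / 1000000) (by norm_num) (by norm_num) (by rw [ht]; norm_num)
  have b0_8 := iterate_rStep_ge_step hC hCτ' b0_7 (by norm_num) (s := 1028043 / 1000000) (xnew := 947889 / 1000000) (by norm_num) (by norm_num) (by rw [ht]; norm_num)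
  have g1 : (947889 / 1000000 : ℝ) ≤ nu 1 (9 / 10) 1 := by
    show _ ≤ Bm 1 (9 / 10) (nu 1 (9 / 10) 0); unfold Bm; rw [show (8 : ℕ) ^ 1 = 7 + 1 by norm_num]; exact b0_8
  -- block 2: ν_2 = r^[8](4·ν_1) ≥ 540799 / 500000
  have b1_0 : (947889 / 250000 : ℝ) ≤ (rStep (9 / 10) (tauS 1))^[0] (4 * nu 1 (9 / 10) 1) := by rw [Function.iterate_zero, id]; linarith [g1]
  have b1_1 := iterate_rStep_ge_step hC hCτ' b1_0 (by norm_num) (s := 243399 / 125000) (xnew := 415123 / 125000) (by norm_num) (by norm_num) (by rw [ht]; norm_num)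
  have b1_2 := iterate_rStep_ge_step hC hCτ' b1_1 (by norm_num) (s := 1822357 / 1000000) (xnew := 719529 / 250000) (by norm_num) (by norm_num) (by rw [ht]; norm_num)
  have b1_3 := iterate_rStep_ge_step hC hCτ' b1_2 (by norm_num) (s := 848251 / 500000) (xnew := 1233653 / 500000) (by norm_num) (by norm_num) (by rw [ht]; norm_num)
  have b1_4 := iterate_rStep_ge_step hC hCτ' b1_3 (by norm_num) (s := 1570767 / 1000000) (xnew := 2093653 / 1000000) (by norm_num) (by norm_num) (by rw [ht]; norm_num)
  have b1_5 := iterate_rStep_ge_step hC hCτ' b1_4 (by norm_num) (s := 1446947 / 1000000) (xnew := 881451 / 500000) (by norm_num) (by norm_num) (by rw [ht]; norm_num)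
  have b1_6 := iterate_rStep_ge_step hC hCτ' b1_5 (by norm_num) (s := 20746 / 15625) (xnew := 1481013 / 1000000) (by norm_num) (by norm_num) (by rw [ht]; norm_num)
  have b1_7 := iterate_rStep_ge_step hC hCτ' b1_6 (by norm_num) (s := 1216969 / 1000000) (xnew := 156639 / 125000) (by norm_num) (by norm_num) (by rw [ht]; norm_num)
  have b1_8 := iterate_rStep_ge_step hC hCτ' b1_7 (by norm_num) (s := 44777 / 40000) (xnew := 540799 / 500000) (by norm_num) (by norm_num) (by rw [ht]; norm_num)
  have g2 : (540799 / 500000 : ℝ) ≤ nu 1 (9 / 10) 2 := by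
    show _ ≤ Bm 1 (9 / 10) (nu 1 (9 / 10) 1); unfold Bm; rw [show (8 : ℕ) ^ 1 = 7 + 1 by norm_num]; exact b1_8
  -- block 3: ν_3 = r^[8](4·ν_2) ≥ 634577 / 500000
  have b2_0 : (540799 / 125000 : ℝ) ≤ (rStep (9 / 10) (tauS 1))^[0] (4 * nu 1 (9 / 10) 2) := by rw [Function.iterate_zero, id]; linarith [g2]
  have b2_1 := iterate_rStep_ge_step hC hCτ' b2_0 (by norm_num) (s := 2079999 / 1000000) (xnew := 3829997 / 1000000) (by norm_num) (by norm_num) (by rw [ht]; norm_num)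
  have b2_2 := iterate_rStep_ge_step hC hCτ' b2_1 (by norm_num) (s := 978519 / 500000) (xnew := 335739 / 100000) (by norm_num) (by norm_num) (by rw [ht]; norm_num)
  have b2_3 := iterate_rStep_ge_step hC hCτ' b2_2 (by norm_num) (s := 1832319 / 1000000) (xnew := 2912173 / 1000000) (by norm_num) (by norm_num) (by rw [ht]; norm_num)
  have b2_4 := iterate_rStep_ge_step hC hCτ' b2_3 (by norm_num) (s := 170651 / 100000) (xnew := 2498641 / 1000000) (by norm_num) (by norm_num) (by rw [ht]; norm_num)
  have b2_5 := iterate_rStep_ge_step hC hCτ' b2_4 (by norm_num) (s := 158071 / 100000) (xnew := 1060917 / 500000) (by norm_num) (by norm_num) (by rw [ht]; norm_num)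
  have b2_6 := iterate_rStep_ge_step hC hCτ' b2_5 (by norm_num) (s := 364163 / 250000) (xnew := 1787457 / 1000000) (by norm_num) (by norm_num) (by rw [ht]; norm_num)
  have b2_7 := iterate_rStep_ge_step hC hCτ' b2_6 (by norm_num) (s := 1336959 / 1000000) (xnew := 37537 / 25000) (by norm_num) (by norm_num) (by rw [ht]; norm_num)
  have b2_8 := iterate_rStep_ge_step hC hCτ' b2_7 (by norm_num) (s := 1225349 / 1000000) (xnew := 634577 / 500000) (by norm_num) (by norm_num) (by rw [ht]; norm_num)
  have g3 : (634577 / 500000 : ℝ) ≤ nu 1 (9 / 10) 3 := by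
    show _ ≤ Bm 1 (9 / 10) (nu 1 (9 / 10) 2); unfold Bm; rw [show (8 : ℕ) ^ 1 = 7 + 1 by norm_num]; exact b2_8
  -- block 4: ν_4 = r^[8](4·ν_3) ≥ 1620747 / 1000000
  have b3_0 : (634577 / 125000 : ℝ) ≤ (rStep (9 / 10) (tauS 1))^[0] (4 * nu 1 (9 / 10) 3) := by rw [Function.iterate_zero, id]; linarith [g3]
  have b3_1 := iterate_rStep_ge_step hC hCτ' b3_0 (by norm_num) (s := 450627 / 200000) (xnew := 4551129 / 1000000) (by norm_num) (by norm_num) (by rw [ht]; norm_num)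
  have b3_2 := iterate_rStep_ge_step hC hCτ' b3_1 (by norm_num) (s := 1066669 / 500000) (xnew := 1011317 / 250000) (by norm_num) (by norm_num) (by rw [ht]; norm_num)
  have b3_3 := iterate_rStep_ge_step hC hCτ' b3_2 (by norm_num) (s := 1005643 / 500000) (xnew := 222613 / 62500) (by norm_num) (by norm_num) (by rw [ht]; norm_num)
  have b3_4 := iterate_rStep_ge_step hC hCτ' b3_3 (by norm_num) (s := 471819 / 250000) (xnew := 776019 / 250000) (by norm_num) (by norm_num) (by rw [ht]; norm_num)
  have b3_5 := iterate_rStep_ge_step hC hCτ' b3_4 (by norm_num) (s := 1761839 / 1000000) (xnew := 669013 / 250000) (by norm_num) (by norm_num) (by rw [ht]; norm_num)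
  have b3_6 := iterate_rStep_ge_step hC hCτ' b3_5 (by norm_num) (s := 327173 / 200000) (xnew := 142653 / 62500) (by norm_num) (by norm_num) (by rw [ht]; norm_num)
  have b3_7 := iterate_rStep_ge_step hC hCτ' b3_6 (by norm_num) (s := 755389 / 500000) (xnew := 964351 / 500000) (by norm_num) (by norm_num) (by rw [ht]; norm_num)
  have b3_8 := iterate_rStep_ge_step hC hCτ' b3_7 (by norm_num) (s := 694389 / 500000) (xnew := 1620747 / 1000000) (by norm_num) (by norm_num) (by rw [ht]; norm_num)
  have g4 : (1620747 / 1000000 : ℝ) ≤ nu 1 (9 / 10) 4 := by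
    show _ ≤ Bm 1 (9 / 10) (nu 1 (9 / 10) 3); unfold Bm; rw [show (8 : ℕ) ^ 1 = 7 + 1 by norm_num]; exact b3_8
  -- block 5: ν_5 = r^[8](4·ν_4) ≥ 248917 / 100000
  have b4_0 : (1620747 / 250000 : ℝ) ≤ (rStep (9 / 10) (tauS 1))^[0] (4 * nu 1 (9 / 10) 4) := by rw [Function.iterate_zero, id]; linarith [g4]
  have b4_1 := iterate_rStep_ge_step hC hCτ' b4_0 (by norm_num) (s := 636543 / 250000) (xnew := 236691 / 40000) (by norm_num) (by norm_num) (by rw [ht]; norm_num)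
  have b4_2 := iterate_rStep_ge_step hC hCτ' b4_1 (by norm_num) (s := 486509 / 200000) (xnew := 536601 / 100000) (by norm_num) (by norm_num) (by rw [ht]; norm_num)
  have b4_3 := iterate_rStep_ge_step hC hCτ' b4_2 (by norm_num) (s := 463293 / 200000) (xnew := 4830967 / 1000000) (by norm_num) (by norm_num) (by rw [ht]; norm_num)
  have b4_4 := iterate_rStep_ge_step hC hCτ' b4_3 (by norm_num) (s := 2197947 / 1000000) (xnew := 862851 / 200000) (by norm_num) (by norm_num) (by rw [ht]; norm_num)
  have b4_5 := iterate_rStep_ge_step hC hCτ' b4_4 (by norm_num) (s := 2077079 / 1000000) (xnew := 3818393 / 1000000) (by norm_num) (by norm_num) (by rw [ht]; norm_num)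
  have b4_6 := iterate_rStep_ge_step hC hCτ' b4_5 (by norm_num) (s := 1954071 / 1000000) (xnew := 3346397 / 1000000) (by norm_num) (by norm_num) (by rw [ht]; norm_num)
  have b4_7 := iterate_rStep_ge_step hC hCτ' b4_6 (by norm_num) (s := 457329 / 250000) (xnew := 580377 / 200000) (by norm_num) (by norm_num) (by rw [ht]; norm_num)
  have b4_8 := iterate_rStep_ge_step hC hCτ' b4_7 (by norm_num) (s := 1703493 / 1000000) (xnew := 248917 / 100000) (by norm_num) (by norm_num) (by rw [ht]; norm_num)
  have g5 : (248917 / 100000 : ℝ) ≤ nu 1 (9 / 10) 5 := by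
    show _ ≤ Bm 1 (9 / 10) (nu 1 (9 / 10) 4); unfold Bm; rw [show (8 : ℕ) ^ 1 = 7 + 1 by norm_num]; exact b4_8
  exact endPossibleLin_bOct_of_escape hC hCτ (n₀ := 5) (by linarith [g5]) hγ₀

/-- **THE OCTAL THRESHOLD TO ONE DECIMAL IN THE KERNEL** · the admissible constants of `bOct` form an up-set with threshold `C⋆ ∈ [4∕5, 9∕10]` (any box):
possible for every `C > C⋆`, impossible for every `0 < C < C⋆` — from (X12)'s `not_endPossibleLin_bOct_080` and `endPossibleLin_bOct_090`; the reading
note's conjecture is `C⋆ = √(84∕(77+72 log 2)) ≈ 0.8136`. [folklore] -/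
theorem exists_threshold_bOct_decimal {γ₀ : ℝ} (hγ₀ : 0 < γ₀) :
    ∃ Cstar : ℝ, 4 / 5 ≤ Cstar ∧ Cstar ≤ 9 / 10 ∧ (∀ C, Cstar < C → EndPossibleLin bOct C γ₀) ∧
      ∀ C, 0 < C → C < Cstar → ¬ EndPossibleLin bOct C γ₀ := by
  set S : Set ℝ := {C | 0 < C ∧ EndPossibleLin bOct C γ₀} with hS
  have h9 : (9 / 10 : ℝ) ∈ S := ⟨by norm_num, endPossibleLin_bOct_090 hγ₀⟩
  have hlow : ∀ C ∈ S, 4 / 5 ≤ C := fun C hC =>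
    le_of_not_gt fun hlt => not_endPossibleLin_bOct_080 hγ₀ (endPossibleLin_mono hlt.le hC.2)
  have hbdd : BddBelow S := ⟨4 / 5, hlow⟩
  refine ⟨sInf S, le_csInf ⟨_, h9⟩ hlow, csInf_le hbdd h9, fun C hC => ?_, fun C hC0 hC hP => ?_⟩
  · obtain ⟨C', hC'S, hC'C⟩ := exists_lt_of_csInf_lt ⟨_, h9⟩ hC
    exact endPossibleLin_mono hC'C.le hC'S.2
  · exact absurd (csInf_le hbdd ⟨hC0, hP⟩) (not_le.mpr hC)

end

end Summit.QuantumFields.BalabanUV.Gaps.EndDrawdownLinearThresholdRenormSuff
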